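import Literature.Analysis.OperatorTheory.PositiveKernelNormLogConvex
import Mathlib.Analysis.CStarAlgebra.Matrix
import Mathlib.Analysis.Matrix.Order
import Mathlib.Analysis.SpecialFunctions.ContinuousFunctionalCalculus.Rpow.Basic
import HarnessLib

/-!
# Log-convexity of the top eigenvalue of a Gram–Laplace matrix
# `G(β)_{ab} = ∫ f_a f_b e^{β q} dμ` — PROVED

Topic `Literature/Analysis/OperatorTheory`; companion of `PositiveKernelNormLogConvex.lean` (Kingman's
log-convexity of the norm of positive-KERNEL operators, and the secant bracket `log_norm_secant_bracket'`)
and of `DiagonalCongruenceNormConvex.lean` (PLAIN convexity of the top eigenvalue of a diagonal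
congruence `D_t Q D_t`). Theorems only (no definition, no named fact).

## 1. The statement

Let `(X, μ)` be a measure space, `S` a finite index set, `f : S → X → ℝ` and `q : X → ℝ` real
functions such that every `f_a f_b e^{β q}` is integrable (e.g. `f_c`, `q` bounded measurable and `μ`
finite: `integrable_mul_mul_exp_mul`). The GRAM–LAPLACE matrix

  `G(β) := (∫ f_a(x) f_b(x) e^{β q(x)} dμ(x))_{a,b ∈ S}`

(the compression to `span{f_c}` of the operator of multiplication by `e^{β q}` on `L²(μ)`) is real
symmetric positive semidefinite with quadratic form `φᵀ G(β) φ = ∫ (Σ_c φ_c f_c)² e^{β q} dμ`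
(`dotProduct_gramExp_mulVec`, `posSemidef_gramExp`), and its ℓ²-operator norm — the largest eigenvalue,
by the Rayleigh–Ritz theorem [cite: HornJohnson2013, Thm. 4.2.2 (c)] — is LOG-CONVEX in `β`:

  `‖G(θs + (1-θ)t)‖ ≤ ‖G(s)‖^θ ‖G(t)‖^{1-θ}`   (`l2_opNorm_gramExp_convexComb_le`),

so `β ↦ log ‖G(β)‖` is convex on any convex set of couplings where `G ≠ 0`
(`convexOn_log_l2_opNorm_gramExp`). Proof: for each `φ` the quadratic form is a Laplace transform
`β ↦ ∫ w e^{β q} dμ` of the non-negative weight `w = (Σ_c φ_c f_c)²`, hence log-convex by HÖLDER's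
inequality (`integral_mul_exp_mul_convexComb_le`) [cite: Dudley2002, §5.1 Thm. 5.1.2 (Hölder)]; and for
a positive semidefinite matrix `‖G‖ = sup_{φᵀφ ≤ 1} φᵀ G φ` (`dotProduct_mulVec_le_l2_opNorm`,
`l2_opNorm_le_of_dotProduct_mulVec_le` — C⋆-identity with `G = R R`, `R = G^{1/2}`), so the norm is
a supremum of log-convex functions, hence log-convex [cite: HiriarturrutyLemarechal2001, §B.1.3 (e),
Prop. B.2.1.2, §D.5.1 (5.1.1) (PDF pp. 92, 95, 191)] — the finite-dimensional compression analogue of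
Kingman's theorem [cite: Kingman1961, Theorem].

## 2. The secant bracket

With `log ‖G(·)‖` convex, the companion file's `log_norm_secant_bracket'` gives, for a unit top
eigenvector `ψ` of `G(β)` (`⟪ψ, G(β)ψ⟫ = ‖G(β)‖ > 0`) and sample couplings `x₁ < x₂ ≤ β ≤ x₃ < x₄`,
`(log ‖G x₂‖ - log ‖G x₁‖)/(x₂-x₁) ≤ g′/‖G β‖ ≤ (log ‖G x₄‖ - log ‖G x₃‖)/(x₄-x₃)` for the
Hellmann–Feynman value `g′ = d/dβ ⟪ψ, G(β) ψ⟫` (`log_l2_opNorm_gramExp_secant_bracket`); for bounded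
`q` this value is `⟪ψ, G′(β) ψ⟫`, `G′(β)_{ab} = ∫ f_a f_b e^{β q} q dμ` (`hasDerivAt_inner_gramExp`,
differentiation under the integral; `log_l2_opNorm_gramExp_secant_bracket_hf`).

## 3. Why this file exists (application, by dictionary only)

Truncated transfer matrices of lattice gauge theory in a character basis, as functions of the SPATIAL
coupling `β_s`, have the shape `W_S(β_s) = G(β_s)` with `f_c = √k_c · χ_c` (`χ_c` the kept basis
functions on the slice configuration space, `k_c ≥ 0` the link weights) and `q` the spatial plaquette
sum: §1 says the top eigenvalue of `W_S` is log-convex in `β_s` for EVERY kept set `S`, §2 that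
certified enclosures of it bracket the normalised Hellmann–Feynman value. Nothing about lattice gauge
theory is formalised here.

## Mathlib / tree search

Mathlib: `ENNReal.lintegral_mul_norm_pow_le` (Hölder), `Matrix.l2_opNorm_conjTranspose_mul_self`,
`Matrix.inner_toEuclideanCLM`, `CFC.sqrt`; tree: `PositiveKernelNormLogConvex.lean`
(`log_norm_secant_bracket'`), `MathematicalPhysics/QuantumFieldTheory/SliceKernelLogConvex.lean`
(`integral_exp_mul_convexComb_le`, the unweighted Hölder step, for KERNELS). No Mathlib statement on
log-convexity of Laplace transforms or of norms of parametrised Gram matrices (`lean search`).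

## References

* J.-B. Hiriart-Urruty, C. Lemaréchal, *Fundamentals of Convex Analysis*, Springer 2001, §B.1.3 (e),
  Prop. B.2.1.2, §D.5.1. [HiriarturrutyLemarechal2001]
* R. A. Horn, C. R. Johnson, *Matrix Analysis*, 2nd ed., CUP 2013, Thm. 4.2.2. [HornJohnson2013]
* R. M. Dudley, *Real Analysis and Probability*, CUP 2002, Thm. 5.1.2 (Hölder), §6.3. [Dudley2002]
* J. F. C. Kingman, *A convexity property of positive matrices*, Quart. J. Math. (2) 12 (1961) 283–284.
  [Kingman1961]
-/

noncomputable section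

open MeasureTheory Set Filter Topology Matrix
open scoped RealInnerProductSpace ENNReal Matrix.Norms.L2Operator MatrixOrder

namespace Literature.Analysis.OperatorTheory

/-! ## 1. Weighted Hölder: `β ↦ ∫ w e^{β q}` is log-convex -/

section WeightedHolder

variable {Y : Type*} [MeasurableSpace Y] {ν : Measure Y}

/-- **Hölder's inequality, weighted log-convexity form**: for a non-negative weight `w`, a real
function `q` and couplings `s, t`, `0 ≤ θ ≤ 1`,
`∫ w e^{(θs+(1-θ)t) q} dν ≤ (∫ w e^{s q} dν)^θ (∫ w e^{t q} dν)^{1-θ}`, provided the three integrands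
are integrable — `β ↦ log ∫ w e^{β q} dν` is convex (log-convexity of Laplace transforms).
[cite: Dudley2002, §5.1 Thm. 5.1.2 (Hölder)] -/
theorem integral_mul_exp_mul_convexComb_le (w q : Y → ℝ) (hw : ∀ y, 0 ≤ w y) {s t θ : ℝ}
    (hθ₀ : 0 ≤ θ) (hθ₁ : θ ≤ 1)
    (hs : Integrable (fun y => w y * Real.exp (s * q y)) ν)
    (ht : Integrable (fun y => w y * Real.exp (t * q y)) ν)
    (hm : Integrable (fun y => w y * Real.exp ((θ * s + (1 - θ) * t) * q y)) ν) :
    ∫ y, w y * Real.exp ((θ * s + (1 - θ) * t) * q y) ∂ν ≤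
      (∫ y, w y * Real.exp (s * q y) ∂ν) ^ θ * (∫ y, w y * Real.exp (t * q y) ∂ν) ^ (1 - θ) := by
  have hθ₁' : 0 ≤ 1 - θ := sub_nonneg.mpr hθ₁
  have h1 : θ + (1 - θ) = 1 := by ring
  -- pointwise: `w e^{(θs+(1-θ)t)q} = (w e^{sq})^θ (w e^{tq})^{1-θ}` (`w ≥ 0`)
  have hpt : ∀ y, w y * Real.exp ((θ * s + (1 - θ) * t) * q y) =
      (w y * Real.exp (s * q y)) ^ θ * (w y * Real.exp (t * q y)) ^ (1 - θ) := by
    intro y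
    rw [Real.mul_rpow (hw y) (Real.exp_pos _).le, Real.mul_rpow (hw y) (Real.exp_pos _).le,
      ← Real.exp_mul, ← Real.exp_mul]
    have hw1 : w y ^ θ * w y ^ (1 - θ) = w y := by
      rw [← Real.rpow_add' (hw y) (by rw [h1]; exact one_ne_zero), h1, Real.rpow_one]
    calc w y * Real.exp ((θ * s + (1 - θ) * t) * q y)
        = (w y ^ θ * w y ^ (1 - θ)) * Real.exp (s * q y * θ + t * q y * (1 - θ)) := by
          rw [hw1]; congr 1; congr 1; ring
      _ = w y ^ θ * Real.exp (s * q y * θ) * (w y ^ (1 - θ) * Real.exp (t * q y * (1 - θ))) := by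
          rw [Real.exp_add]; ring
  have h0s : ∀ y, 0 ≤ w y * Real.exp (s * q y) := fun y => mul_nonneg (hw y) (Real.exp_pos _).le
  have h0t : ∀ y, 0 ≤ w y * Real.exp (t * q y) := fun y => mul_nonneg (hw y) (Real.exp_pos _).le
  have h0m : ∀ y, 0 ≤ w y * Real.exp ((θ * s + (1 - θ) * t) * q y) :=
    fun y => mul_nonneg (hw y) (Real.exp_pos _).le
  have hms : AEMeasurable (fun y => ENNReal.ofReal (w y * Real.exp (s * q y))) ν :=
    hs.aestronglyMeasurable.aemeasurable.ennreal_ofReal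
  have hmt : AEMeasurable (fun y => ENNReal.ofReal (w y * Real.exp (t * q y))) ν :=
    ht.aestronglyMeasurable.aemeasurable.ennreal_ofReal
  have hH : ∫⁻ y, ENNReal.ofReal (w y * Real.exp ((θ * s + (1 - θ) * t) * q y)) ∂ν ≤
      (∫⁻ y, ENNReal.ofReal (w y * Real.exp (s * q y)) ∂ν) ^ θ *
        (∫⁻ y, ENNReal.ofReal (w y * Real.exp (t * q y)) ∂ν) ^ (1 - θ) := by
    calc ∫⁻ y, ENNReal.ofReal (w y * Real.exp ((θ * s + (1 - θ) * t) * q y)) ∂ν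
        = ∫⁻ y, ENNReal.ofReal (w y * Real.exp (s * q y)) ^ θ *
            ENNReal.ofReal (w y * Real.exp (t * q y)) ^ (1 - θ) ∂ν := by
          refine lintegral_congr fun y => ?_
          rw [hpt y, ENNReal.ofReal_mul (Real.rpow_nonneg (h0s y) θ),
            ENNReal.ofReal_rpow_of_nonneg (h0s y) hθ₀, ENNReal.ofReal_rpow_of_nonneg (h0t y) hθ₁']
      _ ≤ _ := ENNReal.lintegral_mul_norm_pow_le hms hmt hθ₀ hθ₁' (by ring)
  have e := ofReal_integral_eq_lintegral_ofReal hm (Eventually.of_forall h0m)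
  have es := ofReal_integral_eq_lintegral_ofReal hs (Eventually.of_forall h0s)
  have et := ofReal_integral_eq_lintegral_ofReal ht (Eventually.of_forall h0t)
  have hIs : 0 ≤ ∫ y, w y * Real.exp (s * q y) ∂ν := integral_nonneg h0s
  have hIt : 0 ≤ ∫ y, w y * Real.exp (t * q y) ∂ν := integral_nonneg h0t
  rw [← e, ← es, ← et, ENNReal.ofReal_rpow_of_nonneg hIs hθ₀, ENNReal.ofReal_rpow_of_nonneg hIt hθ₁',
    ← ENNReal.ofReal_mul (Real.rpow_nonneg hIs θ)] at hH
  exact (ENNReal.ofReal_le_ofReal_iff (by positivity)).mp hH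

end WeightedHolder

/-! ## 2. Quadratic forms versus the ℓ²-operator norm of a real matrix -/

section QuadForm

variable {S : Type*} [Fintype S] [DecidableEq S]

/-- **`φᵀ W φ ≤ ‖W‖ φᵀφ`** for the ℓ²-operator norm (Cauchy–Schwarz in `EuclideanSpace ℝ S`).
[cite: HornJohnson2013, Thm. 5.6.2 (b) with (0.6.3)] -/
theorem dotProduct_mulVec_le_l2_opNorm (W : Matrix S S ℝ) (φ : S → ℝ) :
    φ ⬝ᵥ (W *ᵥ φ) ≤ ‖W‖ * (φ ⬝ᵥ φ) := by
  set v : EuclideanSpace ℝ S := WithLp.toLp 2 φ with hv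
  have hinner : φ ⬝ᵥ (W *ᵥ φ) = ⟪v, toEuclideanCLM (n := S) (𝕜 := ℝ) W v⟫ := by
    rw [Matrix.inner_toEuclideanCLM]
  have hnormv : φ ⬝ᵥ φ = ‖v‖ ^ 2 := by
    rw [EuclideanSpace.real_norm_sq_eq]; simp only [dotProduct, pow_two]; rfl
  rw [hinner, hnormv]
  calc ⟪v, toEuclideanCLM (n := S) (𝕜 := ℝ) W v⟫
      ≤ ‖v‖ * ‖toEuclideanCLM (n := S) (𝕜 := ℝ) W v‖ := real_inner_le_norm _ _
    _ ≤ ‖v‖ * (‖toEuclideanCLM (n := S) (𝕜 := ℝ) W‖ * ‖v‖) :=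
        mul_le_mul_of_nonneg_left (ContinuousLinearMap.le_opNorm _ _) (norm_nonneg _)
    _ = ‖W‖ * ‖v‖ ^ 2 := by rw [Matrix.l2_opNorm_toEuclideanCLM]; ring

/-- **`‖R x‖² = xᵀ (Rᵀ R) x`** for a real matrix acting on `EuclideanSpace ℝ S`.
[cite: HornJohnson2013, §0.6.1 and (0.2.6) (adjoint identity)] -/
theorem norm_toEuclideanCLM_sq_eq_dotProduct (R : Matrix S S ℝ) (x : EuclideanSpace ℝ S) :
    ‖toEuclideanCLM (n := S) (𝕜 := ℝ) R x‖ ^ 2 =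
      WithLp.ofLp x ⬝ᵥ ((Rᵀ * R) *ᵥ WithLp.ofLp x) := by
  rw [EuclideanSpace.real_norm_sq_eq, ← Matrix.mulVec_mulVec, Matrix.dotProduct_mulVec,
    Matrix.vecMul_transpose]
  have h : ∀ i, toEuclideanCLM (n := S) (𝕜 := ℝ) R x i = (R *ᵥ WithLp.ofLp x) i := fun i =>
    congrFun (Matrix.ofLp_toEuclideanCLM R x) i
  simp only [h, dotProduct, pow_two]

/-- **For `W ⪰ 0`, a bound on the quadratic form bounds the norm**: if `φᵀ W φ ≤ c φᵀφ` for all `φ`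
(`c ≥ 0`) then `‖W‖ ≤ c` — i.e. `‖W‖ = sup_{φᵀφ ≤ 1} φᵀ W φ = λ_max(W)` (write `W = R R`, `R = W^{1/2}`
symmetric; `‖W‖ = ‖R‖²` by the C⋆-identity and `‖R x‖² = xᵀ W x ≤ c ‖x‖²`).
[cite: HornJohnson2013, Thm. 4.2.2 (c) (Rayleigh–Ritz) and Thm. 7.2.6] -/
theorem l2_opNorm_le_of_dotProduct_mulVec_le {W : Matrix S S ℝ} (hW : W.PosSemidef) {c : ℝ}
    (hc : 0 ≤ c) (h : ∀ φ : S → ℝ, φ ⬝ᵥ (W *ᵥ φ) ≤ c * (φ ⬝ᵥ φ)) : ‖W‖ ≤ c := by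
  have hW0 : 0 ≤ W := Matrix.nonneg_iff_posSemidef.mpr hW
  set R : Matrix S S ℝ := CFC.sqrt W with hRdef
  have hRR : R * R = W := CFC.sqrt_mul_sqrt_self W hW0
  have hRh : Rᴴ = R := by
    have h' : star R = R := (CFC.sqrt_nonneg W).isSelfAdjoint.star_eq
    rwa [Matrix.star_eq_conjTranspose] at h'
  have hRt : Rᵀ = R := by rw [← Matrix.conjTranspose_eq_transpose_of_trivial]; exact hRh
  -- `‖R‖ ≤ √c`
  have hR : ‖R‖ ≤ Real.sqrt c := by
    rw [← Matrix.l2_opNorm_toEuclideanCLM]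
    refine ContinuousLinearMap.opNorm_le_bound _ (Real.sqrt_nonneg c) fun x => ?_
    have hsq : ‖toEuclideanCLM (n := S) (𝕜 := ℝ) R x‖ ^ 2 ≤ (Real.sqrt c * ‖x‖) ^ 2 := by
      rw [norm_toEuclideanCLM_sq_eq_dotProduct, hRt, hRR, mul_pow, Real.sq_sqrt hc,
        EuclideanSpace.real_norm_sq_eq]
      have hxx : WithLp.ofLp x ⬝ᵥ WithLp.ofLp x = ∑ i, x i ^ 2 := by
        simp only [dotProduct, pow_two]
      rw [← hxx]
      exact h (WithLp.ofLp x)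
    nlinarith [norm_nonneg (toEuclideanCLM (n := S) (𝕜 := ℝ) R x), Real.sqrt_nonneg c,
      norm_nonneg x, mul_nonneg (Real.sqrt_nonneg c) (norm_nonneg x)]
  calc ‖W‖ = ‖Rᴴ * R‖ := by rw [hRh, hRR]
    _ = ‖R‖ * ‖R‖ := Matrix.l2_opNorm_conjTranspose_mul_self R
    _ ≤ Real.sqrt c * Real.sqrt c :=
        mul_le_mul hR hR (norm_nonneg _) (Real.sqrt_nonneg c)
    _ = c := Real.mul_self_sqrt hc

end QuadForm

/-! ## 3. Gram–Laplace matrices `G(β)_{ab} = ∫ f_a f_b e^{β q} dμ` -/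

section GramLaplace

variable {S : Type*} {X : Type*} [MeasurableSpace X] {μ : Measure X}

/-- **Integrability from bounds**: on a finite measure space, for bounded (a.e.-strongly) measurable
`f_c` and `q`, every `f_a f_b e^{β q}` is integrable. [cite: Dudley2002, §4.1 (bounded measurable
functions on a finite measure space are integrable)] -/
theorem integrable_mul_mul_exp_mul [IsFiniteMeasure μ] {f : S → X → ℝ} {q : X → ℝ}
    (hf : ∀ c, AEStronglyMeasurable (f c) μ) (hq : AEStronglyMeasurable q μ) {Cf Cq : ℝ}
    (hfb : ∀ c x, |f c x| ≤ Cf) (hqb : ∀ x, |q x| ≤ Cq) (β : ℝ) (a b : S) :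
    Integrable (fun x => f a x * f b x * Real.exp (β * q x)) μ := by
  refine Integrable.mono' (integrable_const (Cf * Cf * Real.exp (|β| * Cq)))
    (((hf a).mul (hf b)).mul (Real.continuous_exp.comp_aestronglyMeasurable (hq.const_mul β)))
    (Eventually.of_forall fun x => ?_)
  have hCf : 0 ≤ Cf := (abs_nonneg _).trans (hfb a x)
  rw [Real.norm_eq_abs, abs_mul, abs_mul, abs_of_pos (Real.exp_pos _)]
  refine mul_le_mul (mul_le_mul (hfb a x) (hfb b x) (abs_nonneg _) hCf) ?_ (Real.exp_pos _).le
    (mul_nonneg hCf hCf)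
  refine Real.exp_le_exp.mpr ((le_abs_self _).trans ?_)
  rw [abs_mul]
  exact mul_le_mul_of_nonneg_left (hqb x) (abs_nonneg β)

variable [Fintype S]

/-- The weight `(Σ_c φ_c f_c)² h` is integrable when the `f_a f_b h` are (expand the square).
[cite: Dudley2002, §4.1] -/
theorem integrable_sq_sum_mul {f : S → X → ℝ} {h : X → ℝ}
    (hI : ∀ a b, Integrable (fun x => f a x * f b x * h x) μ) (φ : S → ℝ) :
    Integrable (fun x => (∑ c, φ c * f c x) ^ 2 * h x) μ := by
  have hx : (fun x => (∑ c, φ c * f c x) ^ 2 * h x) =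
      fun x => ∑ a, ∑ b, φ a * φ b * (f a x * f b x * h x) := by
    funext x
    rw [sq, Finset.sum_mul_sum, Finset.sum_mul]
    refine Finset.sum_congr rfl fun a _ => ?_
    rw [Finset.sum_mul]
    exact Finset.sum_congr rfl fun b _ => by ring
  rw [hx]
  exact integrable_finsetSum _ fun a _ => integrable_finsetSum _ fun b _ => (hI a b).const_mul _

/-- **The quadratic form of a Gram matrix with weight `h`**: `φᵀ G φ = ∫ (Σ_c φ_c f_c)² h dμ` for
`G_{ab} = ∫ f_a f_b h dμ`. [cite: HornJohnson2013, Thm. 7.2.10 (Gram matrices and their quadratic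
forms)] -/
theorem dotProduct_gram_mulVec {f : S → X → ℝ} {h : X → ℝ}
    (hI : ∀ a b, Integrable (fun x => f a x * f b x * h x) μ) (φ : S → ℝ) :
    φ ⬝ᵥ ((Matrix.of fun a b => ∫ x, f a x * f b x * h x ∂μ) *ᵥ φ) =
      ∫ x, (∑ c, φ c * f c x) ^ 2 * h x ∂μ := by
  have hx : (fun x => (∑ c, φ c * f c x) ^ 2 * h x) =
      fun x => ∑ a, ∑ b, φ a * φ b * (f a x * f b x * h x) := by
    funext x
    rw [sq, Finset.sum_mul_sum, Finset.sum_mul]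
    refine Finset.sum_congr rfl fun a _ => ?_
    rw [Finset.sum_mul]
    exact Finset.sum_congr rfl fun b _ => by ring
  rw [hx, integral_finsetSum _ fun a _ =>
    integrable_finsetSum _ fun b _ => (hI a b).const_mul (φ a * φ b)]
  simp only [dotProduct, Matrix.mulVec, Matrix.of_apply]
  refine Finset.sum_congr rfl fun a _ => ?_
  rw [integral_finsetSum _ fun b _ => (hI a b).const_mul (φ a * φ b), Finset.mul_sum]
  refine Finset.sum_congr rfl fun b _ => ?_
  rw [integral_const_mul]
  ring

/-- **The quadratic form of a Gram–Laplace matrix is a Laplace transform**: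
`φᵀ G(β) φ = ∫ (Σ_c φ_c f_c)² e^{β q} dμ` for `G(β)_{ab} = ∫ f_a f_b e^{β q} dμ`.
[cite: HornJohnson2013, Thm. 7.2.10] -/
theorem dotProduct_gramExp_mulVec {f : S → X → ℝ} {q : X → ℝ} {β : ℝ}
    (hI : ∀ a b, Integrable (fun x => f a x * f b x * Real.exp (β * q x)) μ) (φ : S → ℝ) :
    φ ⬝ᵥ ((Matrix.of fun a b => ∫ x, f a x * f b x * Real.exp (β * q x) ∂μ) *ᵥ φ) =
      ∫ x, (∑ c, φ c * f c x) ^ 2 * Real.exp (β * q x) ∂μ :=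
  dotProduct_gram_mulVec (h := fun x => Real.exp (β * q x)) hI φ

/-- **A Gram–Laplace matrix is positive semidefinite** (real symmetric with non-negative quadratic
form `∫ (Σ φ_c f_c)² e^{β q} ≥ 0`). [cite: HornJohnson2013, Thm. 7.2.10] -/
theorem posSemidef_gramExp {f : S → X → ℝ} {q : X → ℝ} {β : ℝ}
    (hI : ∀ a b, Integrable (fun x => f a x * f b x * Real.exp (β * q x)) μ) :
    (Matrix.of fun a b => ∫ x, f a x * f b x * Real.exp (β * q x) ∂μ).PosSemidef := by
  refine PosSemidef.of_dotProduct_mulVec_nonneg ?_ fun φ => ?_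
  · refine Matrix.IsHermitian.ext fun a b => ?_
    simp only [Matrix.of_apply, star_trivial]
    refine integral_congr_ae (Eventually.of_forall fun x => ?_)
    simp only [mul_comm (f a x) (f b x)]
  · rw [star_trivial, dotProduct_gramExp_mulVec hI]
    exact integral_nonneg fun x => mul_nonneg (sq_nonneg _) (Real.exp_pos _).le

variable [DecidableEq S]

/-- **Log-convexity of the top eigenvalue of a Gram–Laplace matrix, two-point form**: for
`G(β)_{ab} = ∫ f_a f_b e^{β q} dμ` (all `f_a f_b e^{β q}` integrable) and `0 ≤ θ ≤ 1`,
`‖G(θs+(1-θ)t)‖ ≤ ‖G(s)‖^θ ‖G(t)‖^{1-θ}` for the ℓ²-operator norm (= largest eigenvalue of these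
positive semidefinite matrices [cite: HornJohnson2013, Thm. 4.2.2 (c)]). Each quadratic form
`∫ (Σ φ_c f_c)² e^{β q}` is log-convex by Hölder, and the norm is their supremum over `φᵀφ ≤ 1`.
[cite: HiriarturrutyLemarechal2001, §B.1.3 (e), Prop. B.2.1.2, §D.5.1 (5.1.1) (PDF pp. 92, 95, 191)]
[cite: Kingman1961, Theorem] -/
theorem l2_opNorm_gramExp_convexComb_le (f : S → X → ℝ) (q : X → ℝ)
    (hI : ∀ β (a b : S), Integrable (fun x => f a x * f b x * Real.exp (β * q x)) μ)
    {s t θ : ℝ} (hθ₀ : 0 ≤ θ) (hθ₁ : θ ≤ 1) :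
    ‖(Matrix.of fun a b => ∫ x, f a x * f b x * Real.exp ((θ * s + (1 - θ) * t) * q x) ∂μ)‖ ≤
      ‖(Matrix.of fun a b => ∫ x, f a x * f b x * Real.exp (s * q x) ∂μ)‖ ^ θ *
        ‖(Matrix.of fun a b => ∫ x, f a x * f b x * Real.exp (t * q x) ∂μ)‖ ^ (1 - θ) := by
  set Gs : Matrix S S ℝ := Matrix.of fun a b => ∫ x, f a x * f b x * Real.exp (s * q x) ∂μ
  set Gt : Matrix S S ℝ := Matrix.of fun a b => ∫ x, f a x * f b x * Real.exp (t * q x) ∂μ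
  have hθ₁' : 0 ≤ 1 - θ := sub_nonneg.mpr hθ₁
  have h1 : θ + (1 - θ) = 1 := by ring
  refine l2_opNorm_le_of_dotProduct_mulVec_le (posSemidef_gramExp (hI _))
    (mul_nonneg (Real.rpow_nonneg (norm_nonneg _) _) (Real.rpow_nonneg (norm_nonneg _) _))
    fun φ => ?_
  have hφ : 0 ≤ φ ⬝ᵥ φ := by
    simp only [dotProduct]; exact Finset.sum_nonneg fun c _ => mul_self_nonneg _
  -- the quadratic forms as Laplace transforms of `w = (Σ φ_c f_c)²`
  rw [dotProduct_gramExp_mulVec (hI _)]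
  have hHolder := integral_mul_exp_mul_convexComb_le (ν := μ) (fun x => (∑ c, φ c * f c x) ^ 2) q
    (fun x => sq_nonneg _) hθ₀ hθ₁ (integrable_sq_sum_mul (hI s) φ)
    (integrable_sq_sum_mul (hI t) φ) (integrable_sq_sum_mul (hI _) φ)
  refine hHolder.trans ?_
  -- `F(s) ≤ ‖G s‖ φᵀφ`, `F(t) ≤ ‖G t‖ φᵀφ`
  have hFs : ∫ x, (∑ c, φ c * f c x) ^ 2 * Real.exp (s * q x) ∂μ ≤ ‖Gs‖ * (φ ⬝ᵥ φ) := by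
    rw [← dotProduct_gramExp_mulVec (hI s)]; exact dotProduct_mulVec_le_l2_opNorm Gs φ
  have hFt : ∫ x, (∑ c, φ c * f c x) ^ 2 * Real.exp (t * q x) ∂μ ≤ ‖Gt‖ * (φ ⬝ᵥ φ) := by
    rw [← dotProduct_gramExp_mulVec (hI t)]; exact dotProduct_mulVec_le_l2_opNorm Gt φ
  have hFs0 : 0 ≤ ∫ x, (∑ c, φ c * f c x) ^ 2 * Real.exp (s * q x) ∂μ :=
    integral_nonneg fun x => mul_nonneg (sq_nonneg _) (Real.exp_pos _).le
  have hFt0 : 0 ≤ ∫ x, (∑ c, φ c * f c x) ^ 2 * Real.exp (t * q x) ∂μ :=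
    integral_nonneg fun x => mul_nonneg (sq_nonneg _) (Real.exp_pos _).le
  calc (∫ x, (∑ c, φ c * f c x) ^ 2 * Real.exp (s * q x) ∂μ) ^ θ *
        (∫ x, (∑ c, φ c * f c x) ^ 2 * Real.exp (t * q x) ∂μ) ^ (1 - θ)
      ≤ (‖Gs‖ * (φ ⬝ᵥ φ)) ^ θ * (‖Gt‖ * (φ ⬝ᵥ φ)) ^ (1 - θ) :=
        mul_le_mul (Real.rpow_le_rpow hFs0 hFs hθ₀) (Real.rpow_le_rpow hFt0 hFt hθ₁')
          (Real.rpow_nonneg hFt0 _) (Real.rpow_nonneg (mul_nonneg (norm_nonneg _) hφ) _)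
    _ = ‖Gs‖ ^ θ * ‖Gt‖ ^ (1 - θ) * ((φ ⬝ᵥ φ) ^ θ * (φ ⬝ᵥ φ) ^ (1 - θ)) := by
        rw [Real.mul_rpow (norm_nonneg _) hφ, Real.mul_rpow (norm_nonneg _) hφ]; ring
    _ = ‖Gs‖ ^ θ * ‖Gt‖ ^ (1 - θ) * (φ ⬝ᵥ φ) := by
        rw [← Real.rpow_add' hφ (by rw [h1]; exact one_ne_zero), h1, Real.rpow_one]

/-- **`β ↦ log ‖G(β)‖` is convex** on any convex set `D` of couplings on which `G(β) ≠ 0`, for the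
Gram–Laplace family `G(β)_{ab} = ∫ f_a f_b e^{β q} dμ` (Kingman-type log-convexity of the top
eigenvalue of the compression of `e^{β q}` to `span{f_c}`). [cite: Kingman1961, Theorem]
[cite: HiriarturrutyLemarechal2001, Prop. B.2.1.2, §D.5.1 (PDF pp. 95, 191)] -/
theorem convexOn_log_l2_opNorm_gramExp (f : S → X → ℝ) (q : X → ℝ)
    (hI : ∀ β (a b : S), Integrable (fun x => f a x * f b x * Real.exp (β * q x)) μ)
    {D : Set ℝ} (hD : Convex ℝ D)
    (hpos : ∀ β ∈ D, 0 < ‖(Matrix.of fun a b => ∫ x, f a x * f b x * Real.exp (β * q x) ∂μ)‖) :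
    ConvexOn ℝ D (fun β =>
      Real.log ‖(Matrix.of fun a b => ∫ x, f a x * f b x * Real.exp (β * q x) ∂μ)‖) := by
  refine ⟨hD, fun s hs t ht θ η hθ hη hθη => ?_⟩
  have hη' : η = 1 - θ := by linarith
  subst hη'
  have hθ₁ : θ ≤ 1 := by linarith
  have hc : θ • s + (1 - θ) • t ∈ D := hD hs ht hθ hη hθη
  have key := l2_opNorm_gramExp_convexComb_le (μ := μ) f q hI (s := s) (t := t) hθ hθ₁
  have hps := hpos s hs
  have hpt := hpos t ht
  have hpc := hpos _ hc
  simp only [smul_eq_mul] at hpc ⊢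
  calc Real.log ‖(Matrix.of fun a b => ∫ x, f a x * f b x * Real.exp ((θ * s + (1 - θ) * t) * q x) ∂μ)‖
      ≤ Real.log (‖(Matrix.of fun a b => ∫ x, f a x * f b x * Real.exp (s * q x) ∂μ)‖ ^ θ *
          ‖(Matrix.of fun a b => ∫ x, f a x * f b x * Real.exp (t * q x) ∂μ)‖ ^ (1 - θ)) :=
        Real.log_le_log hpc key
    _ = θ * Real.log ‖(Matrix.of fun a b => ∫ x, f a x * f b x * Real.exp (s * q x) ∂μ)‖ +
          (1 - θ) * Real.log ‖(Matrix.of fun a b => ∫ x, f a x * f b x * Real.exp (t * q x) ∂μ)‖ := by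
        rw [Real.log_mul (Real.rpow_pos_of_pos hps θ).ne' (Real.rpow_pos_of_pos hpt _).ne',
          Real.log_rpow hps, Real.log_rpow hpt]

omit [DecidableEq S] in
/-- **Differentiating a Laplace transform with a bounded exponent**: for an integrable weight
`w e^{γ q}` (all `γ`) with `q` bounded and a.e.-strongly measurable,
`d/dγ ∫ w e^{γ q} dμ |_{γ=β} = ∫ w e^{β q} q dμ` (dominated convergence on the ball `|γ - β| < 1`
with the bound `w · e^{(|β|+1) C_q} C_q`). [cite: Dudley2002, §4.3 (dominated convergence) and
Thm. 5.1.2] -/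
theorem hasDerivAt_integral_sq_sum_mul_exp {f : S → X → ℝ} {q : X → ℝ}
    (hI : ∀ γ (a b : S), Integrable (fun x => f a x * f b x * Real.exp (γ * q x)) μ)
    (hq : AEStronglyMeasurable q μ) {Cq : ℝ} (hqb : ∀ x, |q x| ≤ Cq) (φ : S → ℝ) (β : ℝ) :
    HasDerivAt (fun γ => ∫ x, (∑ c, φ c * f c x) ^ 2 * Real.exp (γ * q x) ∂μ)
      (∫ x, (∑ c, φ c * f c x) ^ 2 * (Real.exp (β * q x) * q x) ∂μ) β := by
  have hCq : ∀ x, 0 ≤ Cq := fun x => (abs_nonneg _).trans (hqb x)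
  -- the weight at `γ = 0` is `w` itself
  have hw : Integrable (fun x => (∑ c, φ c * f c x) ^ 2 * Real.exp (0 * q x)) μ :=
    integrable_sq_sum_mul (hI 0) φ
  set K : ℝ := Real.exp ((|β| + 1) * Cq) * Cq with hK
  have h := hasDerivAt_integral_of_dominated_loc_of_deriv_le (μ := μ)
    (F := fun γ x => (∑ c, φ c * f c x) ^ 2 * Real.exp (γ * q x))
    (F' := fun γ x => (∑ c, φ c * f c x) ^ 2 * (Real.exp (γ * q x) * q x))
    (x₀ := β) (bound := fun x => (∑ c, φ c * f c x) ^ 2 * Real.exp (0 * q x) * K)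
    (Metric.ball_mem_nhds β zero_lt_one)
    (Eventually.of_forall fun γ => (integrable_sq_sum_mul (hI γ) φ).aestronglyMeasurable)
    (integrable_sq_sum_mul (hI β) φ)
    (by
      have hm := ((integrable_sq_sum_mul (hI β) φ).aestronglyMeasurable).mul hq
      refine hm.congr (Eventually.of_forall fun x => ?_)
      simp only [Pi.mul_apply]; ring)
    (Eventually.of_forall fun x γ hγ => by
      have hγ' : |γ| ≤ |β| + 1 := by
        have h1 : |γ - β| < 1 := by rw [← Real.dist_eq]; exact Metric.mem_ball.mp hγ
        have h2 : |γ| - |β| ≤ |γ - β| := abs_sub_abs_le_abs_sub γ β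
        linarith
      have hw0 : 0 ≤ (∑ c, φ c * f c x) ^ 2 := sq_nonneg _
      rw [Real.norm_eq_abs, abs_mul, abs_of_nonneg hw0, abs_mul, abs_of_pos (Real.exp_pos _),
        zero_mul, Real.exp_zero, mul_one, hK]
      refine mul_le_mul_of_nonneg_left ?_ hw0
      refine mul_le_mul (Real.exp_le_exp.mpr ?_) (hqb x) (abs_nonneg _) (Real.exp_pos _).le
      calc γ * q x ≤ |γ * q x| := le_abs_self _
        _ = |γ| * |q x| := abs_mul _ _
        _ ≤ (|β| + 1) * Cq := mul_le_mul hγ' (hqb x) (abs_nonneg _) (by positivity))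
    (hw.mul_const K)
    (Eventually.of_forall fun x γ _ =>
      (((Real.hasDerivAt_exp (γ * q x)).comp γ (hasDerivAt_mul_const (q x))).const_mul _))
  exact h.2

omit [Fintype S] [DecidableEq S] in
/-- Integrability of `f_a f_b e^{β q} q` from that of `f_a f_b e^{β q}` and boundedness of `q`.
[cite: Dudley2002, §4.1] -/
theorem integrable_mul_mul_exp_mul_mul {f : S → X → ℝ} {q : X → ℝ} {β : ℝ}
    (hI : ∀ a b, Integrable (fun x => f a x * f b x * Real.exp (β * q x)) μ)
    (hq : AEStronglyMeasurable q μ) {Cq : ℝ} (hqb : ∀ x, |q x| ≤ Cq) (a b : S) :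
    Integrable (fun x => f a x * f b x * (Real.exp (β * q x) * q x)) μ := by
  have h := (hI a b).mul_bdd (c := Cq) hq (Eventually.of_forall fun x => by
    rw [Real.norm_eq_abs]; exact hqb x)
  refine h.congr (Eventually.of_forall fun x => ?_)
  ring

/-- **Hellmann–Feynman value of a Gram–Laplace family**: for `G(γ)_{ab} = ∫ f_a f_b e^{γ q} dμ` with
`q` bounded, `d/dγ ⟪ψ, G(γ) ψ⟫ |_{γ=β} = ⟪ψ, G′(β) ψ⟫` with `G′(β)_{ab} = ∫ f_a f_b e^{β q} q dμ`
(`ψ` FROZEN; differentiation under the integral sign).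
[cite: HiriarturrutyLemarechal2001, §D.5.1 (5.1.2) (PDF p. 191)] [cite: Dudley2002, §4.3] -/
theorem hasDerivAt_inner_gramExp {f : S → X → ℝ} {q : X → ℝ}
    (hI : ∀ γ (a b : S), Integrable (fun x => f a x * f b x * Real.exp (γ * q x)) μ)
    (hq : AEStronglyMeasurable q μ) {Cq : ℝ} (hqb : ∀ x, |q x| ≤ Cq)
    (ψ : EuclideanSpace ℝ S) (β : ℝ) :
    HasDerivAt (fun γ => ⟪ψ, toEuclideanCLM (n := S) (𝕜 := ℝ)
        (Matrix.of fun a b => ∫ x, f a x * f b x * Real.exp (γ * q x) ∂μ) ψ⟫)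
      ⟪ψ, toEuclideanCLM (n := S) (𝕜 := ℝ)
        (Matrix.of fun a b => ∫ x, f a x * f b x * (Real.exp (β * q x) * q x) ∂μ) ψ⟫ β := by
  have hfun : (fun γ => ⟪ψ, toEuclideanCLM (n := S) (𝕜 := ℝ)
        (Matrix.of fun a b => ∫ x, f a x * f b x * Real.exp (γ * q x) ∂μ) ψ⟫) =
      fun γ => ∫ x, (∑ c, WithLp.ofLp ψ c * f c x) ^ 2 * Real.exp (γ * q x) ∂μ := by
    funext γ
    rw [Matrix.inner_toEuclideanCLM, dotProduct_gram_mulVec (hI γ)]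
  have hval : ⟪ψ, toEuclideanCLM (n := S) (𝕜 := ℝ)
        (Matrix.of fun a b => ∫ x, f a x * f b x * (Real.exp (β * q x) * q x) ∂μ) ψ⟫ =
      ∫ x, (∑ c, WithLp.ofLp ψ c * f c x) ^ 2 * (Real.exp (β * q x) * q x) ∂μ := by
    rw [Matrix.inner_toEuclideanCLM,
      dotProduct_gram_mulVec (integrable_mul_mul_exp_mul_mul (hI β) hq hqb)]
  rw [hfun, hval]
  exact hasDerivAt_integral_sq_sum_mul_exp hI hq hqb (WithLp.ofLp ψ) β

/-- **Secant bracket for the Hellmann–Feynman value of a Gram–Laplace family** (sample couplings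
`x₁ < x₂ ≤ β ≤ x₃ < x₄`, all `G ≠ 0` on `[x₁, x₄]`): for a unit vector `ψ` with
`⟪ψ, G(β) ψ⟫ = ‖G(β)‖` (a normalised top eigenvector) and `g′ = d/dβ ⟪ψ, G(β) ψ⟫`,
`(log ‖G x₂‖ - log ‖G x₁‖)/(x₂-x₁) ≤ g′/‖G β‖ ≤ (log ‖G x₄‖ - log ‖G x₃‖)/(x₄-x₃)` — no
differentiability of the top eigenvalue, no simplicity assumed (`log_norm_secant_bracket'` + §3).
[cite: Dudley2002, §6.3 Cor. 6.3.3] [cite: HiriarturrutyLemarechal2001, §D.5.1 (5.1.3) (PDF p. 191)] -/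
theorem log_l2_opNorm_gramExp_secant_bracket (f : S → X → ℝ) (q : X → ℝ)
    (hI : ∀ β (a b : S), Integrable (fun x => f a x * f b x * Real.exp (β * q x)) μ)
    {β x₁ x₂ x₃ x₄ : ℝ} (h12 : x₁ < x₂) (h2 : x₂ ≤ β) (h3 : β ≤ x₃) (h34 : x₃ < x₄)
    (hpos : ∀ γ ∈ Icc x₁ x₄, 0 < ‖(Matrix.of fun a b => ∫ x, f a x * f b x * Real.exp (γ * q x) ∂μ)‖)
    {ψ : EuclideanSpace ℝ S} (hψ : ‖ψ‖ = 1)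
    (htop : ⟪ψ, toEuclideanCLM (n := S) (𝕜 := ℝ)
        (Matrix.of fun a b => ∫ x, f a x * f b x * Real.exp (β * q x) ∂μ) ψ⟫ =
      ‖(Matrix.of fun a b => ∫ x, f a x * f b x * Real.exp (β * q x) ∂μ)‖)
    {g' : ℝ} (hg : HasDerivAt (fun γ => ⟪ψ, toEuclideanCLM (n := S) (𝕜 := ℝ)
        (Matrix.of fun a b => ∫ x, f a x * f b x * Real.exp (γ * q x) ∂μ) ψ⟫) g' β) :
    (Real.log ‖(Matrix.of fun a b => ∫ x, f a x * f b x * Real.exp (x₂ * q x) ∂μ)‖ -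
        Real.log ‖(Matrix.of fun a b => ∫ x, f a x * f b x * Real.exp (x₁ * q x) ∂μ)‖) / (x₂ - x₁) ≤
      g' / ‖(Matrix.of fun a b => ∫ x, f a x * f b x * Real.exp (β * q x) ∂μ)‖ ∧
    g' / ‖(Matrix.of fun a b => ∫ x, f a x * f b x * Real.exp (β * q x) ∂μ)‖ ≤
      (Real.log ‖(Matrix.of fun a b => ∫ x, f a x * f b x * Real.exp (x₄ * q x) ∂μ)‖ -
        Real.log ‖(Matrix.of fun a b => ∫ x, f a x * f b x * Real.exp (x₃ * q x) ∂μ)‖) / (x₄ - x₃) := by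
  have hβ : β ∈ Icc x₁ x₄ := ⟨by linarith, by linarith⟩
  have hT := log_norm_secant_bracket'
    (fun γ => toEuclideanCLM (n := S) (𝕜 := ℝ)
      (Matrix.of fun a b => ∫ x, f a x * f b x * Real.exp (γ * q x) ∂μ)) h12 h2 h3 h34
    (by
      simp only [Matrix.l2_opNorm_toEuclideanCLM]
      exact convexOn_log_l2_opNorm_gramExp f q hI (convex_Icc _ _) hpos)
    hψ (by rw [Matrix.l2_opNorm_toEuclideanCLM]; exact htop)
    (by rw [Matrix.l2_opNorm_toEuclideanCLM]; exact hpos β hβ) hg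
  simpa only [Matrix.l2_opNorm_toEuclideanCLM] using hT

/-- **Secant bracket for a Gram–Laplace family, Hellmann–Feynman value explicit** (`q` bounded):
as `log_l2_opNorm_gramExp_secant_bracket` with `g′ = ⟪ψ, G′(β) ψ⟫`, `G′(β)_{ab} = ∫ f_a f_b e^{β q} q dμ`
supplied by `hasDerivAt_inner_gramExp`. [cite: Dudley2002, §6.3 Cor. 6.3.3]
[cite: HiriarturrutyLemarechal2001, §D.5.1 (5.1.3) (PDF p. 191)] -/
theorem log_l2_opNorm_gramExp_secant_bracket_hf (f : S → X → ℝ) (q : X → ℝ)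
    (hI : ∀ β (a b : S), Integrable (fun x => f a x * f b x * Real.exp (β * q x)) μ)
    (hq : AEStronglyMeasurable q μ) {Cq : ℝ} (hqb : ∀ x, |q x| ≤ Cq)
    {β x₁ x₂ x₃ x₄ : ℝ} (h12 : x₁ < x₂) (h2 : x₂ ≤ β) (h3 : β ≤ x₃) (h34 : x₃ < x₄)
    (hpos : ∀ γ ∈ Icc x₁ x₄, 0 < ‖(Matrix.of fun a b => ∫ x, f a x * f b x * Real.exp (γ * q x) ∂μ)‖)
    {ψ : EuclideanSpace ℝ S} (hψ : ‖ψ‖ = 1)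
    (htop : ⟪ψ, toEuclideanCLM (n := S) (𝕜 := ℝ)
        (Matrix.of fun a b => ∫ x, f a x * f b x * Real.exp (β * q x) ∂μ) ψ⟫ =
      ‖(Matrix.of fun a b => ∫ x, f a x * f b x * Real.exp (β * q x) ∂μ)‖) :
    (Real.log ‖(Matrix.of fun a b => ∫ x, f a x * f b x * Real.exp (x₂ * q x) ∂μ)‖ -
        Real.log ‖(Matrix.of fun a b => ∫ x, f a x * f b x * Real.exp (x₁ * q x) ∂μ)‖) / (x₂ - x₁) ≤
      ⟪ψ, toEuclideanCLM (n := S) (𝕜 := ℝ)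
          (Matrix.of fun a b => ∫ x, f a x * f b x * (Real.exp (β * q x) * q x) ∂μ) ψ⟫ /
        ‖(Matrix.of fun a b => ∫ x, f a x * f b x * Real.exp (β * q x) ∂μ)‖ ∧
    ⟪ψ, toEuclideanCLM (n := S) (𝕜 := ℝ)
          (Matrix.of fun a b => ∫ x, f a x * f b x * (Real.exp (β * q x) * q x) ∂μ) ψ⟫ /
        ‖(Matrix.of fun a b => ∫ x, f a x * f b x * Real.exp (β * q x) ∂μ)‖ ≤
      (Real.log ‖(Matrix.of fun a b => ∫ x, f a x * f b x * Real.exp (x₄ * q x) ∂μ)‖ -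
        Real.log ‖(Matrix.of fun a b => ∫ x, f a x * f b x * Real.exp (x₃ * q x) ∂μ)‖) / (x₄ - x₃) :=
  log_l2_opNorm_gramExp_secant_bracket f q hI h12 h2 h3 h34 hpos hψ htop
    (hasDerivAt_inner_gramExp hI hq hqb ψ β)

end GramLaplace

end Literature.Analysis.OperatorTheory

end
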